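import Summits.Parity.GeneralizedHardyLittlewood.Theorems.BeyondDiagonalBeatsQuarter.OffDiagCoreWinFactor
import HarnessLib

/-!
# Route `PrimeLevelFamEdge`, crux K_B (stmt-Parity-20343), line `diagonal_kernel_split` rev 4, plan Ω,
# node **L7d part 2, leaf $₁ — the UNIVERSAL level weight of the separated family is `≤ 2/√q` and its block ℓ²-mass is
# `≤ 4·#Q/N`** (L7D-PLAN rev 6 §6 $; the `‖F‖₂` factor of F2b `norm_sum_family_levelFactor_le`)

After S₃/S₅ the level weight seen by the large sieve is `g_{k,w}(q)·ρ_j(q)` with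
`g_{k,w}(q) = e(kq/P)·(2q̂(q)·2π/q)·u(q)^{|w|}`, `u(q) = (log q̂(q)^{Δ′})⁻¹`, `ρ_j(q) = ((1/q − t₀)/ℓ)^j`. Since
`(2πq̂)² = q`: `|2q̂·2π/q| = 2/√q`; `|u| ≤ 1` once `q̂^{Δ′} ≥ e`; `|ρ_j| ≤ 1` on the block. Hence
`‖g_{k,w}ρ_j‖ ≤ 2/√q ≤ 2/√N` on levels `q > N` and `Σ_{q∈Q} ‖g_{k,w}(q)ρ_j(q)‖² ≤ 4·#Q/N`.

* `norm_levelNu_eq`, `abs_levelU_le_one`, `abs_rho_pow_le_one`, **`norm_universalWeight_le`**, **`sum_norm_sq_universalWeight_le`**,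
  `sum_norm_universalWeight_le`.

Elementary; standard axioms. Helper toward `stub_offDiagBelowSlack_io`; closes nothing.
«The programme SEARCHES and TYPES; no claim about Landau–Siegel zeros, Theorems 1–2 of arXiv:2211.02515 or
a repaired Margin232 until a kernel theorem says so.»
-/

noncomputable section

open Finset Real

namespace Summit.Parity.GeneralizedHardyLittlewood.Theorems.BeyondDiagonalBeatsQuarter.OffDiag

open Literature.NumberTheory.LFunctions Literature.NumberTheory.LFunctions.KMV2000
open Literature.NumberTheory.Sieve.LargeSieve (e norm_e)
open PeterssonSplit (two_pi_mul_qhat_sq)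

/-- `‖2q̂(q)·(2π/q)‖ = 2/√q` for `q ≥ 1` (`(2πq̂)² = q`). [cite: KowalskiMichelVanderKam2000, §1 p. 1 — derivation] -/
theorem norm_levelNu_eq {q : ℕ} (hq : 1 ≤ q) : ‖2 * (qhat q : ℂ) * (2 * π / q)‖ = 2 / Real.sqrt q := by
  have hq0 : (0 : ℝ) < q := by exact_mod_cast hq
  have hQ : 0 ≤ qhat q := by unfold qhat; positivity
  have hsq : 2 * π * qhat q = Real.sqrt q := by
    rw [← Real.sqrt_sq (by positivity : 0 ≤ 2 * π * qhat q), two_pi_mul_qhat_sq]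
  have h1 : 2 * (qhat q : ℂ) * (2 * π / q) = (((2 * (2 * π * qhat q) / q : ℝ)) : ℂ) := by push_cast; ring
  rw [h1, Complex.norm_real, Real.norm_eq_abs, abs_of_nonneg (by positivity), hsq,
    div_eq_div_iff hq0.ne' (Real.sqrt_pos.mpr hq0).ne', mul_assoc, Real.mul_self_sqrt hq0.le]

/-- `|u(q)| = |(log q̂^{Δ′})⁻¹| ≤ 1` once `q̂(q)^{Δ′} ≥ e`. [folklore] -/
theorem abs_levelU_le_one {q : ℕ} {Δ' : ℝ} (h : Real.exp 1 ≤ qhat q ^ Δ') : |(Real.log (qhat q ^ Δ'))⁻¹| ≤ 1 := by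
  have hlog : 1 ≤ Real.log (qhat q ^ Δ') := by
    rw [← Real.log_exp 1]
    exact Real.log_le_log (Real.exp_pos 1) h
  rw [abs_inv, abs_of_pos (by linarith)]
  exact inv_le_one_of_one_le₀ hlog

/-- `|ρ_j(q)| = |((1/q − t₀)/ℓ)^j| ≤ 1` when `1/q ∈ [t₀, t₀+ℓ]`, `ℓ > 0`. [folklore] -/
theorem abs_rho_pow_le_one {q : ℕ} {t₀ ℓ : ℝ} (hℓ : 0 < ℓ) (hq : ((q : ℝ))⁻¹ ∈ Set.Icc t₀ (t₀ + ℓ)) (j : ℕ) :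
    |((((q : ℝ))⁻¹ - t₀) / ℓ) ^ j| ≤ 1 := by
  rw [abs_pow]
  refine pow_le_one₀ (abs_nonneg _) ?_
  rw [abs_div, abs_of_pos hℓ, div_le_one hℓ, abs_of_nonneg (by linarith [hq.1])]
  linarith [hq.2]

/-- **The universal level weight is `≤ 2/√q`**: for `q ≥ 1` with `q̂^{Δ′} ≥ e`, `1/q` in the block, any `k, P, n, j`:
`‖e(kq/P)·2q̂(2π/q)·u(q)^n·ρ_j(q)‖ ≤ 2/√q`. [cite: KowalskiMichelVanderKam2000, §1 p. 1 — derivation] -/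
theorem norm_universalWeight_le {q : ℕ} (hq : 1 ≤ q) {Δ' : ℝ} (hU : Real.exp 1 ≤ qhat q ^ Δ') (k P n : ℕ)
    {t₀ ℓ : ℝ} (hℓ : 0 < ℓ) (hqt : ((q : ℝ))⁻¹ ∈ Set.Icc t₀ (t₀ + ℓ)) (j : ℕ) :
    ‖e ((k : ℝ) * q / P) * (2 * (qhat q : ℂ) * (2 * π / q)) * (((Real.log (qhat q ^ Δ'))⁻¹ ^ n : ℝ) : ℂ) *
        ((((((q : ℝ))⁻¹ - t₀) / ℓ) ^ j : ℝ) : ℂ)‖ ≤ 2 / Real.sqrt q := by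
  rw [norm_mul, norm_mul, norm_mul, norm_e, one_mul, norm_levelNu_eq hq, Complex.norm_real, Complex.norm_real,
    Real.norm_eq_abs, Real.norm_eq_abs, abs_pow]
  have h1 : |(Real.log (qhat q ^ Δ'))⁻¹| ^ n ≤ 1 := pow_le_one₀ (abs_nonneg _) (abs_levelU_le_one hU)
  have h2 := abs_rho_pow_le_one hℓ hqt j
  have h0 : 0 ≤ 2 / Real.sqrt q := by positivity
  calc _ ≤ 2 / Real.sqrt q * 1 * 1 := by gcongr
    _ = _ := by ring

/-- **Block ℓ²-mass of the universal level weight**: for levels `Q` with `N < q`, `q̂^{Δ′} ≥ e`, `1/q` in the block: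
`Σ_{q∈Q} ‖g(q)ρ_j(q)‖² ≤ 4·#Q/N`. [folklore] -/
theorem sum_norm_sq_universalWeight_le (Q : Finset ℕ) {N : ℕ} (hN : 1 ≤ N) (hQ : ∀ q ∈ Q, N < q)
    {Δ' : ℝ} (hU : ∀ q ∈ Q, Real.exp 1 ≤ qhat q ^ Δ') (k P n : ℕ) {t₀ ℓ : ℝ} (hℓ : 0 < ℓ)
    (hqt : ∀ q ∈ Q, ((q : ℝ))⁻¹ ∈ Set.Icc t₀ (t₀ + ℓ)) (j : ℕ) :
    ∑ q ∈ Q, ‖e ((k : ℝ) * q / P) * (2 * (qhat q : ℂ) * (2 * π / q)) * (((Real.log (qhat q ^ Δ'))⁻¹ ^ n : ℝ) : ℂ) *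
        ((((((q : ℝ))⁻¹ - t₀) / ℓ) ^ j : ℝ) : ℂ)‖ ^ 2 ≤ 4 * Q.card / N := by
  have hN0 : (0 : ℝ) < N := by exact_mod_cast hN
  have hterm : ∀ q ∈ Q, ‖e ((k : ℝ) * q / P) * (2 * (qhat q : ℂ) * (2 * π / q)) *
      (((Real.log (qhat q ^ Δ'))⁻¹ ^ n : ℝ) : ℂ) * ((((((q : ℝ))⁻¹ - t₀) / ℓ) ^ j : ℝ) : ℂ)‖ ^ 2 ≤ 4 / N := by
    intro q hq
    have hq1 : 1 ≤ q := le_of_lt (lt_of_le_of_lt hN (hQ q hq))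
    have hq0 : (0 : ℝ) < q := by exact_mod_cast hq1
    have h := norm_universalWeight_le hq1 (hU q hq) k P n hℓ (hqt q hq) j
    have hNq : (N : ℝ) ≤ q := by exact_mod_cast (hQ q hq).le
    calc _ ≤ (2 / Real.sqrt q) ^ 2 := pow_le_pow_left₀ (norm_nonneg _) h 2
      _ = 4 / q := by rw [div_pow, Real.sq_sqrt hq0.le]; norm_num
      _ ≤ 4 / N := div_le_div_of_nonneg_left (by norm_num) hN0 hNq
  calc _ ≤ ∑ _q ∈ Q, (4 : ℝ) / N := Finset.sum_le_sum hterm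
    _ = 4 * Q.card / N := by rw [Finset.sum_const, nsmul_eq_mul]; ring

/-- **Block ℓ¹-mass** (for the Taylor remainder of F2b): `Σ_{q∈Q} ‖g(q)‖ ≤ 2·#Q/√N` for levels `N < q` with `q̂^{Δ′} ≥ e`.
[folklore] -/
theorem sum_norm_universalWeight_le (Q : Finset ℕ) {N : ℕ} (hN : 1 ≤ N) (hQ : ∀ q ∈ Q, N < q)
    {Δ' : ℝ} (hU : ∀ q ∈ Q, Real.exp 1 ≤ qhat q ^ Δ') (k P n : ℕ) :
    ∑ q ∈ Q, ‖e ((k : ℝ) * q / P) * (2 * (qhat q : ℂ) * (2 * π / q)) * (((Real.log (qhat q ^ Δ'))⁻¹ ^ n : ℝ) : ℂ)‖ ≤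
      2 * Q.card / Real.sqrt N := by
  have hN0 : (0 : ℝ) < N := by exact_mod_cast hN
  have hterm : ∀ q ∈ Q, ‖e ((k : ℝ) * q / P) * (2 * (qhat q : ℂ) * (2 * π / q)) *
      (((Real.log (qhat q ^ Δ'))⁻¹ ^ n : ℝ) : ℂ)‖ ≤ 2 / Real.sqrt N := by
    intro q hq
    have hq1 : 1 ≤ q := le_of_lt (lt_of_le_of_lt hN (hQ q hq))
    have hq0 : (0 : ℝ) < q := by exact_mod_cast hq1
    -- use the weight lemma with the trivial block `[1/q, 1/q + 1]`, `j = 0`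
    have h := norm_universalWeight_le hq1 (hU q hq) k P n zero_lt_one (t₀ := ((q : ℝ))⁻¹)
      ⟨le_refl _, by linarith⟩ 0
    rw [pow_zero, Complex.ofReal_one, mul_one] at h
    have hNq : Real.sqrt N ≤ Real.sqrt q := Real.sqrt_le_sqrt (by exact_mod_cast (hQ q hq).le)
    exact h.trans (div_le_div_of_nonneg_left (by norm_num) (Real.sqrt_pos.mpr hN0) hNq)
  calc _ ≤ ∑ _q ∈ Q, (2 : ℝ) / Real.sqrt N := Finset.sum_le_sum hterm
    _ = 2 * Q.card / Real.sqrt N := by rw [Finset.sum_const, nsmul_eq_mul]; ring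

end Summit.Parity.GeneralizedHardyLittlewood.Theorems.BeyondDiagonalBeatsQuarter.OffDiag
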